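import Summits.MatrixMultiplication.OmegaCensus.CubeHomometric
import Summits.MatrixMultiplication.OmegaCensus.DominoStructure
import Summits.MatrixMultiplication.OmegaCensus.CubeLawParity
import HarnessLib

/-!
# Structure theorem for ALL cube law shapes in generalized dihedral groups — the TPP statement

ω-census `pub-omega`, family (b3), seat pub-omega-group gen 6.  Framing: lottery ticket; floor = certified bounds/negative
ranges.  VALUE: a theorem about the group-theoretic method (TPP triples in dihedral-like groups); NOT progress on ω.

**Theorem (`cube_structure_of_law`).** Let `G` carry a dihedral-like presentation `ρ, τ : A → G` over a finite abelian group
`A` with `c₀ = 0` (generalized dihedral group `Dih(A)`), and let `(S, T, U)` be a TPP triple whose coset parts have CUBE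
sizes (`|S₀| = |S₁|`, `|T₀| = |T₁|`, `|U₀| = |U₁|`) and which attains the law `3|S||T||U| + 8 = 8|A|`.  Then every one of
`S, T, U` is a union of left cosets of an order-two subgroup: `S₁ = κ_S − S₀`, `T₁ = κ_T − T₀`, `U₁ = κ_U − U₀`.
This is the cell's gen-4 STRUCTURE CONJECTURE for every cube shape `(c,c | d,d | e,e)` (the domino case `c = 1`, any `c₀`, is
`DominoStructureTPP.lean`).

Proof: the eight vertex near-tilings (`vertex000_charsum`, `vertex111_charsum` applied to the triple and to its three right
translates by `τ0`, whose parts are `(−X₁, −X₀)`) give the eight unit equations of `CubeHomometric.cube_homometric` at every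
non-trivial character; Lemma Ω for products of character sums (`eisenstein_zero_of_mem_adjoin`, `3 ∤ |A| = 3cde+1`); then
`CubeStructureChar.cube_structure_of_homometric_charsums`.
-/

namespace Summit.MatrixMultiplication.OmegaCensus

open Literature.Combinatorics.Additive Finset Polynomial IntermediateField

/-! ## Lemma Ω for arbitrary elements of `ℚ(μ_|A|)` (same proof as `charsum_sq_add_mul_add_sq_eq_zero`) -/

section Omega

variable {A : Type*} [AddCommGroup A] [Fintype A]

/-- If `3 ∤ |A|`, two elements `z₀, z₁` of `ℚ(μ) ⊂ ℂ` (`μ` a primitive `|A|`-th root of unity, realised as `ζ³` with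
`ζ = e^{2πi/(3|A|)}`) with `z₀² + z₀z₁ + z₁² = 0` both vanish. [folklore] -/
theorem eisenstein_zero_of_mem_adjoin (h3 : ¬ 3 ∣ Fintype.card A) {z₀ z₁ : ℂ}
    (hz₀K : z₀ ∈ ℚ⟮(Complex.exp (2 * Real.pi * Complex.I / (3 * Fintype.card A : ℕ))) ^ 3⟯)
    (hz₁K : z₁ ∈ ℚ⟮(Complex.exp (2 * Real.pi * Complex.I / (3 * Fintype.card A : ℕ))) ^ 3⟯)
    (h : z₀ ^ 2 + z₀ * z₁ + z₁ ^ 2 = 0) : z₀ = 0 ∧ z₁ = 0 := by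
  set n := Fintype.card A with hndef
  have hn : 0 < n := Fintype.card_pos
  set ζ : ℂ := Complex.exp (2 * Real.pi * Complex.I / (3 * n : ℕ)) with hζdef
  have h3n : 0 < 3 * n := by omega
  have hζ : IsPrimitiveRoot ζ (3 * n) := Complex.isPrimitiveRoot_exp (3 * n) h3n.ne'
  have hω : IsPrimitiveRoot (ζ ^ n) 3 := hζ.pow h3n (by ring)
  set K := ℚ⟮ζ ^ 3⟯ with hKdef
  by_cases hz1 : z₁ = 0
  · refine ⟨?_, hz1⟩
    rw [hz1, mul_zero, add_zero, zero_pow two_ne_zero, add_zero] at h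
    exact pow_eq_zero_iff two_ne_zero |>.mp h
  · exfalso
    set l := z₀ / z₁ with hl
    have hlK : l ∈ K := div_mem hz₀K hz₁K
    have hl2 : l ^ 2 + l + 1 = 0 := by
      have : (l ^ 2 + l + 1) * z₁ ^ 2 = z₀ ^ 2 + z₀ * z₁ + z₁ ^ 2 := by
        rw [hl]; field_simp
      have hz : z₁ ^ 2 ≠ 0 := pow_ne_zero 2 hz1
      have := this.trans h
      exact (mul_eq_zero.mp this).resolve_right hz
    have hl3 : l ^ 3 = 1 := by
      have : l ^ 3 - 1 = (l - 1) * (l ^ 2 + l + 1) := by ring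
      rw [hl2, mul_zero] at this
      exact sub_eq_zero.mp this
    have hl1 : l ≠ 1 := by
      intro h1; rw [h1] at hl2; norm_num at hl2
    haveI : NeZero (3 : ℕ) := ⟨by norm_num⟩
    obtain ⟨i, hi, hil⟩ := hω.eq_pow_of_pow_eq_one hl3
    have hωK : ζ ^ n ∈ K := by
      interval_cases i
      · exfalso; rw [pow_zero] at hil; exact hl1 hil.symm
      · rw [pow_one] at hil; rw [hil]; exact hlK
      · have h1 : (ζ ^ n) ^ 3 = 1 := hω.pow_eq_one
        have e : ζ ^ n = ((ζ ^ n) ^ 2) ^ 2 := by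
          have : ((ζ ^ n) ^ 2) ^ 2 = (ζ ^ n) ^ 3 * ζ ^ n := by ring
          rw [this, h1, one_mul]
        rw [e, hil]
        exact pow_mem hlK 2
    exact zeta_pow_not_mem_adjoin n hn h3 hωK

/-- Lemma Ω for PRODUCTS of two character sums. [folklore] -/
theorem charsum_prod_sq_add_mul_add_sq_eq_zero (h3 : ¬ 3 ∣ Fintype.card A) (ψ : AddChar A ℂ) (X Y X' Y' : Finset A)
    (h : ((∑ a ∈ X, ψ a) * ∑ a ∈ Y, ψ a) ^ 2 + ((∑ a ∈ X, ψ a) * ∑ a ∈ Y, ψ a) * ((∑ a ∈ X', ψ a) * ∑ a ∈ Y', ψ a) +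
      ((∑ a ∈ X', ψ a) * ∑ a ∈ Y', ψ a) ^ 2 = 0) :
    (∑ a ∈ X, ψ a) * (∑ a ∈ Y, ψ a) = 0 ∧ (∑ a ∈ X', ψ a) * (∑ a ∈ Y', ψ a) = 0 :=
  eisenstein_zero_of_mem_adjoin h3 (mul_mem (charsum_mem_adjoin ψ X) (charsum_mem_adjoin ψ Y))
    (mul_mem (charsum_mem_adjoin ψ X') (charsum_mem_adjoin ψ Y')) h

end Omega

/-! ## Vertex near-tilings as character identities -/

section Vertices

variable {A : Type*} [AddCommGroup A] [DecidableEq A] [Fintype A] {G : Type} [Group G] [DecidableEq G]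
  {ρ τ : A → G} {c₀ : A} {S T U : Finset G}

/-- **Vertex `000`, complex characters.** If the boxes `S₁+T₀+U₀`, `S₀+T₁+U₀`, `S₀+T₀+U₁` of a TPP triple have total size
`|A| − 1`, there is a point `x` with `σ₁τ₀υ₀ + σ₀τ₁υ₀ + σ₀τ₀υ₁ = −ψ(x)` for every non-trivial `ψ`. [folklore] -/
theorem vertex000_charsum (hρρ : ∀ a b, ρ a * ρ b = ρ (a + b)) (hρτ : ∀ a b, ρ a * τ b = τ (b - a))
    (hτρ : ∀ a b, τ a * ρ b = τ (a + b)) (hττ : ∀ a b, τ a * τ b = ρ (c₀ + b - a))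
    (hρ : Function.Injective ρ) (hτ : Function.Injective τ) (hne : ∀ a b, ρ a ≠ τ b)
    (h : TripleProductProperty S T U)
    (h000 : (univ.filter fun a : A => τ a ∈ S).card * (univ.filter fun a : A => ρ a ∈ T).card *
        (univ.filter fun a : A => ρ a ∈ U).card +
      (univ.filter fun a : A => ρ a ∈ S).card * (univ.filter fun a : A => τ a ∈ T).card *
        (univ.filter fun a : A => ρ a ∈ U).card +
      (univ.filter fun a : A => ρ a ∈ S).card * (univ.filter fun a : A => ρ a ∈ T).card *
        (univ.filter fun a : A => τ a ∈ U).card + 1 = Fintype.card A) :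
    ∃ x : A, ∀ ψ : AddChar A ℂ, ψ ≠ 0 →
      (∑ a ∈ univ.filter (fun a : A => τ a ∈ S), ψ a) * (∑ a ∈ univ.filter (fun a : A => ρ a ∈ T), ψ a) *
          (∑ a ∈ univ.filter (fun a : A => ρ a ∈ U), ψ a) +
        (∑ a ∈ univ.filter (fun a : A => ρ a ∈ S), ψ a) * (∑ a ∈ univ.filter (fun a : A => τ a ∈ T), ψ a) *
          (∑ a ∈ univ.filter (fun a : A => ρ a ∈ U), ψ a) +
        (∑ a ∈ univ.filter (fun a : A => ρ a ∈ S), ψ a) * (∑ a ∈ univ.filter (fun a : A => ρ a ∈ T), ψ a) *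
          (∑ a ∈ univ.filter (fun a : A => τ a ∈ U), ψ a) = -ψ x := by
  set S₀ : Finset A := univ.filter fun a => ρ a ∈ S with hS₀
  set S₁ : Finset A := univ.filter fun a => τ a ∈ S with hS₁
  set T₀ : Finset A := univ.filter fun a => ρ a ∈ T with hT₀
  set T₁ : Finset A := univ.filter fun a => τ a ∈ T with hT₁
  set U₀ : Finset A := univ.filter fun a => ρ a ∈ U with hU₀
  set U₁ : Finset A := univ.filter fun a => τ a ∈ U with hU₁
  have mS₀ : ∀ a ∈ S₀, cond false (τ a) (ρ a) ∈ S := fun a ha => by simpa [hS₀] using ha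
  have mS₁ : ∀ a ∈ S₁, cond true (τ a) (ρ a) ∈ S := fun a ha => by simpa [hS₁] using ha
  have mT₀ : ∀ a ∈ T₀, cond false (τ a) (ρ a) ∈ T := fun a ha => by simpa [hT₀] using ha
  have mT₁ : ∀ a ∈ T₁, cond true (τ a) (ρ a) ∈ T := fun a ha => by simpa [hT₁] using ha
  have mU₀ : ∀ a ∈ U₀, cond false (τ a) (ρ a) ∈ U := fun a ha => by simpa [hU₀] using ha
  have mU₁ : ∀ a ∈ U₁, cond true (τ a) (ρ a) ∈ U := fun a ha => by simpa [hU₁] using ha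
  have cs := card_sumset' hρρ hττ hρ hτ h
  have inj := sum_injOn' hρρ hττ hρ hτ h
  have d₁ := disjoint_sumset₁' hρρ hρτ hτρ hττ hne h
  have d₂ := disjoint_sumset₂' hρρ hρτ hτρ hττ hne h
  have d₃ := disjoint_sumset₃' hρρ hρτ hτρ hττ hne h
  have hPQ := d₁ false mS₁ mT₀ mU₀ mS₀ mT₁
  have hPR := (d₃ false mS₀ mT₀ mU₁ mS₁ mU₀).symm
  have hQR := d₂ false mS₀ mT₁ mU₀ mS₀ mT₀ mU₁
  obtain ⟨x, hx⟩ := exists_missed_point hPQ hPR hQR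
    (by rw [cs true false false mS₁ mT₀ mU₀, cs false true false mS₀ mT₁ mU₀, cs false false true mS₀ mT₀ mU₁]; exact h000)
  refine ⟨x, fun ψ hψ => ?_⟩
  have key := charsum_near_tiling' hPQ hPR hQR hx ψ hψ
  rw [charsum_sumset' ψ (inj true false false mS₁ mT₀ mU₀), charsum_sumset' ψ (inj false true false mS₀ mT₁ mU₀),
    charsum_sumset' ψ (inj false false true mS₀ mT₀ mU₁)] at key
  exact key

/-- **Vertex `111`, complex characters.** [folklore] -/
theorem vertex111_charsum (hρρ : ∀ a b, ρ a * ρ b = ρ (a + b)) (hρτ : ∀ a b, ρ a * τ b = τ (b - a))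
    (hτρ : ∀ a b, τ a * ρ b = τ (a + b)) (hττ : ∀ a b, τ a * τ b = ρ (c₀ + b - a))
    (hρ : Function.Injective ρ) (hτ : Function.Injective τ) (hne : ∀ a b, ρ a ≠ τ b)
    (h : TripleProductProperty S T U)
    (h111 : (univ.filter fun a : A => ρ a ∈ S).card * (univ.filter fun a : A => τ a ∈ T).card *
        (univ.filter fun a : A => τ a ∈ U).card +
      (univ.filter fun a : A => τ a ∈ S).card * (univ.filter fun a : A => ρ a ∈ T).card *
        (univ.filter fun a : A => τ a ∈ U).card +
      (univ.filter fun a : A => τ a ∈ S).card * (univ.filter fun a : A => τ a ∈ T).card *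
        (univ.filter fun a : A => ρ a ∈ U).card + 1 = Fintype.card A) :
    ∃ x : A, ∀ ψ : AddChar A ℂ, ψ ≠ 0 →
      (∑ a ∈ univ.filter (fun a : A => ρ a ∈ S), ψ a) * (∑ a ∈ univ.filter (fun a : A => τ a ∈ T), ψ a) *
          (∑ a ∈ univ.filter (fun a : A => τ a ∈ U), ψ a) +
        (∑ a ∈ univ.filter (fun a : A => τ a ∈ S), ψ a) * (∑ a ∈ univ.filter (fun a : A => ρ a ∈ T), ψ a) *
          (∑ a ∈ univ.filter (fun a : A => τ a ∈ U), ψ a) +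
        (∑ a ∈ univ.filter (fun a : A => τ a ∈ S), ψ a) * (∑ a ∈ univ.filter (fun a : A => τ a ∈ T), ψ a) *
          (∑ a ∈ univ.filter (fun a : A => ρ a ∈ U), ψ a) = -ψ x := by
  set S₀ : Finset A := univ.filter fun a => ρ a ∈ S with hS₀
  set S₁ : Finset A := univ.filter fun a => τ a ∈ S with hS₁
  set T₀ : Finset A := univ.filter fun a => ρ a ∈ T with hT₀
  set T₁ : Finset A := univ.filter fun a => τ a ∈ T with hT₁
  set U₀ : Finset A := univ.filter fun a => ρ a ∈ U with hU₀
  set U₁ : Finset A := univ.filter fun a => τ a ∈ U with hU₁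
  have mS₀ : ∀ a ∈ S₀, cond false (τ a) (ρ a) ∈ S := fun a ha => by simpa [hS₀] using ha
  have mS₁ : ∀ a ∈ S₁, cond true (τ a) (ρ a) ∈ S := fun a ha => by simpa [hS₁] using ha
  have mT₀ : ∀ a ∈ T₀, cond false (τ a) (ρ a) ∈ T := fun a ha => by simpa [hT₀] using ha
  have mT₁ : ∀ a ∈ T₁, cond true (τ a) (ρ a) ∈ T := fun a ha => by simpa [hT₁] using ha
  have mU₀ : ∀ a ∈ U₀, cond false (τ a) (ρ a) ∈ U := fun a ha => by simpa [hU₀] using ha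
  have mU₁ : ∀ a ∈ U₁, cond true (τ a) (ρ a) ∈ U := fun a ha => by simpa [hU₁] using ha
  have cs := card_sumset' hρρ hττ hρ hτ h
  have inj := sum_injOn' hρρ hττ hρ hτ h
  have d₁ := disjoint_sumset₁' hρρ hρτ hτρ hττ hne h
  have d₂ := disjoint_sumset₂' hρρ hρτ hτρ hττ hne h
  have d₃ := disjoint_sumset₃' hρρ hρτ hτρ hττ hne h
  have hPQ := (d₁ true mS₁ mT₀ mU₁ mS₀ mT₁).symm
  have hPR := d₃ true mS₀ mT₁ mU₁ mS₁ mU₀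
  have hQR := (d₂ true mS₁ mT₁ mU₀ mS₁ mT₀ mU₁).symm
  obtain ⟨x, hx⟩ := exists_missed_point hPQ hPR hQR
    (by rw [cs false true true mS₀ mT₁ mU₁, cs true false true mS₁ mT₀ mU₁, cs true true false mS₁ mT₁ mU₀]; exact h111)
  refine ⟨x, fun ψ hψ => ?_⟩
  have key := charsum_near_tiling' hPQ hPR hQR hx ψ hψ
  rw [charsum_sumset' ψ (inj false true true mS₀ mT₁ mU₁), charsum_sumset' ψ (inj true false true mS₁ mT₀ mU₁),
    charsum_sumset' ψ (inj true true false mS₁ mT₁ mU₀)] at key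
  exact key

omit [Fintype A] [DecidableEq G] in
/-- Character sum of `X.image (−c − ·)`: `ψ(−c) · ∑_X ψ(−a)`. [folklore] -/
theorem charsum_image_neg_sub (ψ : AddChar A ℂ) (X : Finset A) (c : A) :
    ∑ a ∈ X.image (fun b => -c - b), ψ a = ψ (-c) * ∑ a ∈ X, ψ (-a) := by
  rw [sum_image fun _ _ _ _ hab => sub_right_injective hab, mul_sum]
  refine sum_congr rfl fun a _ => ?_
  simp only [sub_eq_add_neg, AddChar.map_add_eq_mul]

omit [Fintype A] [DecidableEq G] in
/-- Character sum of `X.image (− ·)`: `∑_X ψ(−a)`. [folklore] -/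
theorem charsum_image_neg (ψ : AddChar A ℂ) (X : Finset A) :
    ∑ a ∈ X.image (fun b => -b), ψ a = ∑ a ∈ X, ψ (-a) := by
  rw [sum_image fun _ _ _ _ hab => neg_injective hab]

/-! ## The theorem -/

/-- **Structure of cube law triples in generalized dihedral groups.**  `Dih(A)` (`c₀ = 0`); a TPP triple with cube part
sizes attaining `3|S||T||U| + 8 = 8|A|`.  Then `S₁ = κ_S − S₀`, `T₁ = κ_T − T₀`, `U₁ = κ_U − U₀` for some
`κ_S, κ_T, κ_U ∈ A`. [folklore] -/
theorem cube_structure_of_law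
    (hρρ : ∀ a b, ρ a * ρ b = ρ (a + b)) (hρτ : ∀ a b, ρ a * τ b = τ (b - a))
    (hτρ : ∀ a b, τ a * ρ b = τ (a + b)) (hττ : ∀ a b, τ a * τ b = ρ (c₀ + b - a)) (hc₀ : c₀ = 0)
    (hρ : Function.Injective ρ) (hτ : Function.Injective τ) (hne : ∀ a b, ρ a ≠ τ b)
    (hsurj : ∀ g, (∃ a, ρ a = g) ∨ (∃ a, τ a = g)) (h : TripleProductProperty S T U)
    (hS : (univ.filter fun a : A => ρ a ∈ S).card = (univ.filter fun a : A => τ a ∈ S).card)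
    (hT : (univ.filter fun a : A => ρ a ∈ T).card = (univ.filter fun a : A => τ a ∈ T).card)
    (hU : (univ.filter fun a : A => ρ a ∈ U).card = (univ.filter fun a : A => τ a ∈ U).card)
    (hV : 3 * (S.card * T.card * U.card) + 8 = 8 * Fintype.card A) :
    ∃ κS κT κU : A,
      (univ.filter fun a : A => τ a ∈ S) = (univ.filter fun a : A => ρ a ∈ S).image (fun b => κS - b) ∧
      (univ.filter fun a : A => τ a ∈ T) = (univ.filter fun a : A => ρ a ∈ T).image (fun b => κT - b) ∧
      (univ.filter fun a : A => τ a ∈ U) = (univ.filter fun a : A => ρ a ∈ U).image (fun b => κU - b) := by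
  subst hc₀
  set S₀ : Finset A := univ.filter fun a => ρ a ∈ S with hS₀
  set S₁ : Finset A := univ.filter fun a => τ a ∈ S with hS₁
  set T₀ : Finset A := univ.filter fun a => ρ a ∈ T with hT₀
  set T₁ : Finset A := univ.filter fun a => τ a ∈ T with hT₁
  set U₀ : Finset A := univ.filter fun a => ρ a ∈ U with hU₀
  set U₁ : Finset A := univ.filter fun a => τ a ∈ U with hU₁
  -- numerics: `|A| = 3 s₀ t₀ u₀ + 1`, hence `3 ∤ |A|`
  have cS := card_eq_parts' hρ hτ hne hsurj S
  have cT := card_eq_parts' hρ hτ hne hsurj T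
  have cU := card_eq_parts' hρ hτ hne hsurj U
  have hprod : S.card * T.card * U.card = 8 * (S₀.card * T₀.card * U₀.card) := by
    rw [cS, cT, cU, ← hS, ← hT, ← hU]; ring
  rw [hprod] at hV
  have hN : S₀.card * T₀.card * U₀.card + S₀.card * T₀.card * U₀.card + S₀.card * T₀.card * U₀.card + 1 =
      Fintype.card A := by omega
  have h3 : ¬ 3 ∣ Fintype.card A := by omega
  -- the translated triples and their parts
  have er : (Equiv.mulRight (1 : G)).toEmbedding = Function.Embedding.refl G := by ext x; simp
  have hS' := h.map_mulRight (τ 0) 1 1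
  have hT' := h.map_mulRight 1 (τ 0) 1
  have hU' := h.map_mulRight 1 1 (τ 0)
  simp only [er, Finset.map_refl] at hS' hT' hU'
  have cρ := card_rho_part_mulRight_tau hρρ hρτ hττ (A := A)
  have cτ := card_tau_part_mulRight_tau hρρ hττ (A := A)
  have pρ := rho_part_mulRight_tau hρρ hρτ hττ (A := A)
  have pτ := tau_part_mulRight_tau hρρ hττ (A := A)
  -- the eight vertex identities (with missed points)
  obtain ⟨x₁, E1⟩ := vertex000_charsum hρρ hρτ hτρ hττ hρ hτ hne h (by rw [← hS, ← hT, ← hU]; exact hN)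
  obtain ⟨x₂, E2⟩ := vertex111_charsum hρρ hρτ hτρ hττ hρ hτ hne h (by rw [← hS, ← hT, ← hU]; exact hN)
  obtain ⟨x₃, E3⟩ := vertex000_charsum hρρ hρτ hτρ hττ hρ hτ hne hS' (by rw [cρ, cτ, ← hS, ← hT, ← hU]; exact hN)
  obtain ⟨x₄, E4⟩ := vertex111_charsum hρρ hρτ hτρ hττ hρ hτ hne hS' (by rw [cρ, cτ, ← hS, ← hT, ← hU]; exact hN)
  obtain ⟨x₅, E5⟩ := vertex000_charsum hρρ hρτ hτρ hττ hρ hτ hne hT' (by rw [cρ, cτ, ← hS, ← hT, ← hU]; exact hN)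
  obtain ⟨x₆, E6⟩ := vertex111_charsum hρρ hρτ hτρ hττ hρ hτ hne hT' (by rw [cρ, cτ, ← hS, ← hT, ← hU]; exact hN)
  obtain ⟨x₇, E7⟩ := vertex000_charsum hρρ hρτ hτρ hττ hρ hτ hne hU' (by rw [cρ, cτ, ← hS, ← hT, ← hU]; exact hN)
  obtain ⟨x₈, E8⟩ := vertex111_charsum hρρ hρτ hτρ hττ hρ hτ hne hU' (by rw [cρ, cτ, ← hS, ← hT, ← hU]; exact hN)
  -- rewrite the parts of the translates: ρ-part of X·τ0 = X₁.image (−c₀ − ·), τ-part = X₀.image (− ·)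
  simp only [pρ, pτ] at E3 E4 E5 E6 E7 E8
  -- per character: homometry and structure
  have main : ∀ ψ : AddChar A ℂ, ψ ≠ 0 →
      (∑ a ∈ S₀, ψ a) * (∑ a ∈ S₀, ψ (-a)) = (∑ a ∈ S₁, ψ a) * (∑ a ∈ S₁, ψ (-a)) ∧
      (∑ a ∈ T₀, ψ a) * (∑ a ∈ T₀, ψ (-a)) = (∑ a ∈ T₁, ψ a) * (∑ a ∈ T₁, ψ (-a)) ∧
      (∑ a ∈ U₀, ψ a) * (∑ a ∈ U₀, ψ (-a)) = (∑ a ∈ U₁, ψ a) * (∑ a ∈ U₁, ψ (-a)) := by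
    intro ψ hψ
    have cj : ∀ X : Finset A, (∑ a ∈ X, ψ (-a)) = (starRingEnd ℂ) (∑ a ∈ X, ψ a) := fun X => (conj_charsum' ψ X).symm
    have cp : ∀ x : A, ψ (-x) = (starRingEnd ℂ) (ψ x) := fun x => AddChar.map_neg_eq_conj ψ x
    have un : ∀ x : A, ψ x * ψ (-x) = 1 := fun x => by
      rw [← AddChar.map_add_eq_mul, add_neg_cancel, AddChar.map_zero_eq_one]
    have e1 := E1 ψ hψ; have e2 := E2 ψ hψ; have e3 := E3 ψ hψ; have e4 := E4 ψ hψ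
    have e5 := E5 ψ hψ; have e6 := E6 ψ hψ; have e7 := E7 ψ hψ; have e8 := E8 ψ hψ
    simp only [neg_zero, zero_sub, charsum_image_neg] at e3 e4 e5 e6 e7 e8
    -- conjugate equations
    have cj' : ∀ X : Finset A, (starRingEnd ℂ) (∑ a ∈ X, ψ (-a)) = ∑ a ∈ X, ψ a := fun X => by
      rw [cj, starRingEnd_self_apply]
    have c1 := congrArg (starRingEnd ℂ) e1; have c2 := congrArg (starRingEnd ℂ) e2
    have c3 := congrArg (starRingEnd ℂ) e3; have c4 := congrArg (starRingEnd ℂ) e4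
    have c5 := congrArg (starRingEnd ℂ) e5; have c6 := congrArg (starRingEnd ℂ) e6
    have c7 := congrArg (starRingEnd ℂ) e7; have c8 := congrArg (starRingEnd ℂ) e8
    simp only [map_add, map_mul, map_neg, cj', ← cj, ← cp] at c1 c2 c3 c4 c5 c6 c7 c8
    exact cube_homometric (∑ a ∈ S₀, ψ a) (∑ a ∈ S₁, ψ a) (∑ a ∈ T₀, ψ a) (∑ a ∈ T₁, ψ a) (∑ a ∈ U₀, ψ a) (∑ a ∈ U₁, ψ a)
      (∑ a ∈ S₀, ψ (-a)) (∑ a ∈ S₁, ψ (-a)) (∑ a ∈ T₀, ψ (-a)) (∑ a ∈ T₁, ψ (-a)) (∑ a ∈ U₀, ψ (-a)) (∑ a ∈ U₁, ψ (-a))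
      (ψ x₁) (ψ x₂) (ψ x₃) (ψ x₄) (ψ x₅) (ψ x₆) (ψ x₇) (ψ x₈)
      (ψ (-x₁)) (ψ (-x₂)) (ψ (-x₃)) (ψ (-x₄)) (ψ (-x₅)) (ψ (-x₆)) (ψ (-x₇)) (ψ (-x₈))
      (cj S₀) (cj S₁) (cj T₀) (cj T₁) (cj U₀) (cj U₁)
      (un x₁) (un x₂) (un x₃) (un x₄) (un x₅) (un x₆) (un x₇) (un x₈)
      (by linear_combination e1) (by linear_combination e2) (by linear_combination e3) (by linear_combination e4)
      (by linear_combination e5) (by linear_combination e6) (by linear_combination e7) (by linear_combination e8)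
      (by linear_combination c1) (by linear_combination c2) (by linear_combination c3) (by linear_combination c4)
      (by linear_combination c5) (by linear_combination c6) (by linear_combination c7) (by linear_combination c8)
      (charsum_prod_sq_add_mul_add_sq_eq_zero h3 ψ S₁ T₀ S₀ T₁)
      (charsum_prod_sq_add_mul_add_sq_eq_zero h3 ψ S₁ U₀ S₀ U₁)
      (charsum_prod_sq_add_mul_add_sq_eq_zero h3 ψ T₁ U₀ T₀ U₁)
  have key := cube_structure_of_homometric_charsums (S₀ := S₀) (S₁ := S₁) (T₀ := T₀) (T₁ := T₁) (U₀ := U₀) (U₁ := U₁)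
    (x₁ := x₁) (x₃ := x₃) (x₅ := x₅) (x₇ := x₇) hS hT hU
    (fun ψ hψ => (main ψ hψ).1) (fun ψ hψ => (main ψ hψ).2.1) (fun ψ hψ => (main ψ hψ).2.2)
    (fun ψ hψ => E1 ψ hψ)
    (fun ψ hψ => by
      have e3 := E3 ψ hψ
      simp only [neg_zero, zero_sub, charsum_image_neg] at e3
      linear_combination e3)
    (fun ψ hψ => by
      have e5 := E5 ψ hψ
      simp only [neg_zero, zero_sub, charsum_image_neg] at e5
      linear_combination e5)
    (fun ψ hψ => by
      have e7 := E7 ψ hψ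
      simp only [neg_zero, zero_sub, charsum_image_neg] at e7
      linear_combination e7)
  exact ⟨x₁ - x₃, x₁ - x₅, x₁ - x₇, key.1, key.2.1, key.2.2⟩

end Vertices

end Summit.MatrixMultiplication.OmegaCensus
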